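import Mathlib
import HarnessLib
import HarnessLib.Audit
import Summits.RiemannHypothesis.Statement
import Literature.NumberTheory.LFunctions.WeilExplicit
import Literature.NumberTheory.LFunctions.RiemannXi
import Literature.NumberTheory.LFunctions.RiemannXiProofs
import Literature.Analysis.Complex.Hurwitz

/-!
# Theses-free copies of the route propositions of route `WeilGroundState` (build refactor)

This module restates, as plain `def … : Prop` with the SAME terms, every statement item of the route file
`Summits/RiemannHypothesis/RiemannHypothesis/Theses/WeilGroundState.lean` (namespace
`Summit.RiemannHypothesis.RiemannHypothesis.Theses.WeilGroundState`), in the namespace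
`Summit.RiemannHypothesis.RiemannHypothesis.Theorems.WeilRouteProps.WeilGroundState` (the route's deciding theorem `closes` is
deliberately NOT copied — gate5 ruling 2026-08-26T22:17Z).

WHY (21-frontier standing build rule 2026-08-26T18:52:29Z; director-rh BRIEF-weil-import-refactor): only LEAF modules
(closers nobody imports) may import a `Theses` (route) file, so that a route edit invalidates a few dozen leaves instead of
the ≈3 000-module cone that used to hang below the route file. Towers, certificate shards and libraries that need to
MENTION a route proposition (as a hypothesis or in a type) import this module instead; it imports exactly what the route
file imports and never a `Theses` file.

Each copy is definitionally equal to the route declaration (same term); the leaf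
`Theorems/WeilRouteProps/WeilGroundStateIff.lean` records `Theorems.WeilRouteProps.WeilGroundState.X ↔ Theses.WeilGroundState.X` by `Iff.rfl` for every
item `X`, so a closer proves the route declaration from a tower theorem about the copy by `exact` (definitional unfolding)
or through that `Iff`. These definitions are NOT route items (no `@[route_item]`), carry no status, and must be kept
textually in sync with the route file if a statement is ever restated (the `Iff.rfl` leaf then fails loudly).
Nothing here bears on the truth of RH.
-/

namespace Summit.RiemannHypothesis.RiemannHypothesis.Theorems.WeilRouteProps.WeilGroundState

open scoped BigOperators Topology Manifold Classical MeasureTheory ProbabilityTheory Matrix InnerProductSpace ComplexConjugate ContinuousMap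
open Filter Set Function TopologicalSpace MeasureTheory
open Summit

/-- Theses-free copy (build refactor) of the route proposition
`Summit.RiemannHypothesis.RiemannHypothesis.Theses.WeilGroundState.GroundStateSimpleEven` (item stmt-RiemannHypothesis-1526, crux): the same term, hence
definitionally equal to it (`WeilRouteProps.WeilGroundStateIff`). Not a route item; see the route file for the informal statement,
status and sources. -/
def GroundStateSimpleEven : Prop :=
  ∀ a : ℝ, 0 < a → ∃ φ : ℝ → ℂ, ∃ δ : ℝ, 0 < δ ∧ ∀ g : ℝ → ℂ, Literature.NumberTheory.LFunctions.IsWeilTest g → tsupport g ⊆ Icc (-a) a → ∫ t, ‖g t‖ ^ 2 = (1 : ℝ) → ((∀ t, g (-t) = -g t) ∨ ((∀ t, g (-t) = g t) ∧ ∫ t, starRingEnd ℂ (φ t) * g t = 0)) → Literature.NumberTheory.LFunctions.weilGroundEnergy a + δ ≤ (Literature.NumberTheory.LFunctions.weilQuadratic g).re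

/-- Theses-free copy (build refactor) of the route proposition
`Summit.RiemannHypothesis.RiemannHypothesis.Theses.WeilGroundState.GroundStatesConvergeToXi` (item stmt-RiemannHypothesis-1527, crux): the same term, hence
definitionally equal to it (`WeilRouteProps.WeilGroundStateIff`). Not a route item; see the route file for the informal statement,
status and sources. -/
def GroundStatesConvergeToXi : Prop :=
  ∃ a : ℕ → ℝ, ∃ u : ℕ → ℝ → ℂ, ∃ c : ℕ → ℂ, Tendsto a atTop atTop ∧ (∀ k, 0 < a k ∧ c k ≠ 0 ∧ MemLp (u k) 2 ∧ ∃ g : ℕ → ℝ → ℂ, (∀ n, Literature.NumberTheory.LFunctions.IsWeilTest (g n) ∧ tsupport (g n) ⊆ Icc (-(a k)) (a k) ∧ ∫ t, ‖g n t‖ ^ 2 = (1 : ℝ)) ∧ Tendsto (fun n => (Literature.NumberTheory.LFunctions.weilQuadratic (g n)).re) atTop (𝓝 (Literature.NumberTheory.LFunctions.weilGroundEnergy (a k))) ∧ Tendsto (fun n => ∫ t, ‖g n t - u k t‖ ^ 2) atTop (𝓝 0)) ∧ TendstoLocallyUniformlyOn (fun k s => c k * Literature.NumberTheory.LFunctions.weilMellin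 (u k) s) Literature.NumberTheory.LFunctions.riemannXi atTop {s : ℂ | 0 < s.re ∧ s.re < 1}

/-- Theses-free copy (build refactor) of the route proposition
`Summit.RiemannHypothesis.RiemannHypothesis.Theses.WeilGroundState.GroundStateMellinRealZeros` (item stmt-RiemannHypothesis-1528, support): the same term, hence
definitionally equal to it (`WeilRouteProps.WeilGroundStateIff`). Not a route item; see the route file for the informal statement,
status and sources. -/
def GroundStateMellinRealZeros : Prop :=
  ∀ a : ℝ, 0 < a → (∃ φ : ℝ → ℂ, ∃ δ : ℝ, 0 < δ ∧ ∀ g : ℝ → ℂ, Literature.NumberTheory.LFunctions.IsWeilTest g → tsupport g ⊆ Icc (-a) a → ∫ t, ‖g t‖ ^ 2 = (1 : ℝ) → ((∀ t, g (-t) = -g t) ∨ ((∀ t, g (-t) = g t) ∧ ∫ t, starRingEnd ℂ (φ t) * g t = 0)) → Literature.NumberTheory.LFunctions.weilGroundEnergy a + δ ≤ (Literature.NumberTheory.LFunctions.weilQuadratic g).re) → ∀ u : ℝ → ℂ, MemLp u 2 → (∃ g : ℕ → ℝ → ℂ, (∀ n, Literature.NumberTheory.LFunctions.IsWeilTest (g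 n) ∧ tsupport (g n) ⊆ Icc (-a) a ∧ ∫ t, ‖g n t‖ ^ 2 = (1 : ℝ)) ∧ Tendsto (fun n => (Literature.NumberTheory.LFunctions.weilQuadratic (g n)).re) atTop (𝓝 (Literature.NumberTheory.LFunctions.weilGroundEnergy a)) ∧ Tendsto (fun n => ∫ t, ‖g n t - u t‖ ^ 2) atTop (𝓝 0)) → Differentiable ℂ (Literature.NumberTheory.LFunctions.weilMellin u) ∧ ∀ s : ℂ, Literature.NumberTheory.LFunctions.weilMellin u s = 0 → s.re = 1 / 2

/-- Theses-free copy (build refactor) of the route proposition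
`Summit.RiemannHypothesis.RiemannHypothesis.Theses.WeilGroundState.ArchimedeanWindowSimpleEven` (item stmt-RiemannHypothesis-1529, support): the same term, hence
definitionally equal to it (`WeilRouteProps.WeilGroundStateIff`). Not a route item; see the route file for the informal statement,
status and sources. -/
def ArchimedeanWindowSimpleEven : Prop :=
  ∃ φ : ℝ → ℂ, ∃ δ : ℝ, 0 < δ ∧ ∀ g : ℝ → ℂ, Literature.NumberTheory.LFunctions.IsWeilTest g → tsupport g ⊆ Icc (-(Real.log 2 / 2)) (Real.log 2 / 2) → ∫ t, ‖g t‖ ^ 2 = (1 : ℝ) → ((∀ t, g (-t) = -g t) ∨ ((∀ t, g (-t) = g t) ∧ ∫ t, starRingEnd ℂ (φ t) * g t = 0)) → Literature.NumberTheory.LFunctions.weilGroundEnergy (Real.log 2 / 2) + δ ≤ (Literature.NumberTheory.LFunctions.weilQuadratic g).re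

/-- Theses-free copy (build refactor) of the route proposition
`Summit.RiemannHypothesis.RiemannHypothesis.Theses.WeilGroundState.MarkovPartPositiveGroundState` (item stmt-RiemannHypothesis-1530, support): the same term, hence
definitionally equal to it (`WeilRouteProps.WeilGroundStateIff`). Not a route item; see the route file for the informal statement,
status and sources. -/
def MarkovPartPositiveGroundState : Prop :=
  ∀ a : ℝ, 0 < a → ∃ u : ℝ → ℂ, MemLp u 2 ∧ (∀ t, u (-t) = u t) ∧ (∀ t ∈ Ioo (-a) a, 0 < (u t).re ∧ (u t).im = 0) ∧ ∀ g : ℕ → ℝ → ℂ, (∀ n, Literature.NumberTheory.LFunctions.IsWeilTest (g n) ∧ tsupport (g n) ⊆ Icc (-a) a ∧ ∫ t, ‖g n t‖ ^ 2 = (1 : ℝ)) → Tendsto (fun n => (Literature.NumberTheory.LFunctions.weilQuadratic (g n)).re - 2 * ‖∫ t, g n t * (Real.cosh (t / 2) : ℂ)‖ ^ 2 + 2 * ‖∫ t, g n t * (Real.sinh (t / 2) : ℂ)‖ ^ 2) atTop (𝓝 (sInf {x : ℝ | ∃ h : ℝ → ℂ, Literature.NumberTheory.LFunctions.IsWeilTest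 h ∧ tsupport h ⊆ Icc (-a) a ∧ ∫ t, ‖h t‖ ^ 2 = (1 : ℝ) ∧ x = (Literature.NumberTheory.LFunctions.weilQuadratic h).re - 2 * ‖∫ t, h t * (Real.cosh (t / 2) : ℂ)‖ ^ 2 + 2 * ‖∫ t, h t * (Real.sinh (t / 2) : ℂ)‖ ^ 2})) → ∃ c : ℕ → ℂ, (∀ n, ‖c n‖ = 1) ∧ Tendsto (fun n => ∫ t, ‖c n * g n t - u t‖ ^ 2) atTop (𝓝 0)

/-- Theses-free copy (build refactor) of the route proposition
`Summit.RiemannHypothesis.RiemannHypothesis.Theses.WeilGroundState.SmallWindowsSimpleEven` (item stmt-RiemannHypothesis-1531, support): the same term, hence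
definitionally equal to it (`WeilRouteProps.WeilGroundStateIff`). Not a route item; see the route file for the informal statement,
status and sources. -/
def SmallWindowsSimpleEven : Prop :=
  ∃ a₀ : ℝ, 0 < a₀ ∧ ∀ a : ℝ, 0 < a → a ≤ a₀ → ∃ φ : ℝ → ℂ, ∃ δ : ℝ, 0 < δ ∧ ∀ g : ℝ → ℂ, Literature.NumberTheory.LFunctions.IsWeilTest g → tsupport g ⊆ Icc (-a) a → ∫ t, ‖g t‖ ^ 2 = (1 : ℝ) → ((∀ t, g (-t) = -g t) ∨ ((∀ t, g (-t) = g t) ∧ ∫ t, starRingEnd ℂ (φ t) * g t = 0)) → Literature.NumberTheory.LFunctions.weilGroundEnergy a + δ ≤ (Literature.NumberTheory.LFunctions.weilQuadratic g).re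

/-- Theses-free copy (build refactor) of the route proposition
`Summit.RiemannHypothesis.RiemannHypothesis.Theses.WeilGroundState.Assembly` (item stmt-RiemannHypothesis-1532, assembly): the same term, hence
definitionally equal to it (`WeilRouteProps.WeilGroundStateIff`). Not a route item; see the route file for the informal statement,
status and sources. -/
def Assembly : Prop :=
  GroundStateSimpleEven → GroundStateMellinRealZeros → GroundStatesConvergeToXi → Summit.RiemannHypothesis

end Summit.RiemannHypothesis.RiemannHypothesis.Theorems.WeilRouteProps.WeilGroundState
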